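import Summits.CriticalPhenomena.PercolationContinuityZ3.Theorems.PercNearOneGluingNoHeavyLowerTailSahiSunflowerTower
import Mathlib.Tactic.Linarith
import Mathlib.Tactic.Ring
import HarnessLib

/-!
# `NoHeavyLowerTail` (crux stmt-CriticalPhenomena-4575), master-family line P2 (Sahi's algebraic route):
# the SIGN LEMMA for a cell slot and the MONOTONE PETAL CHAIN on `Sun m`

Support file (seat `prim-masterthm-p2`, gen 4; `--supports stmt-CriticalPhenomena-4575`); no definition, no named fact, no sorry.  Memo SAHI-ROUTE.md §4.13.
The engine of the all-`m` hierarchy theorem ("whole Sahi hierarchy on `Sun m` = the single row"):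

* **SIGN LEMMA** `sahiE_cons_nonpos_of_cell` (any finite weighted set, any `N`): if a head slot `w` with `E w ≥ 0` is, for every other member
  `f_i`, either absorbed (`f_i·w = w`, "the cell lies inside the member") or annihilated (`f_i·w = 0`, "disjoint"), at least one member annihilates
  it, and every sub-family of the `f`'s of size `≤ N+1` drawn from a class `P` has `E ≥ 0`, then `E_{N+2}(w, f) ≤ 0`.  Proof: the Lieb–Sahi recursion
  peels `w`; an annihilated slot gives `0`, an absorbed slot gives `E_{N+1}(w, f ∖ f_i) ≤ 0` by induction (the annihilating member survives), and the
  last term is `−E_{N+1}(f)·E(w) ≤ 0`.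
* **MONOTONE STEP** `sahiE_U_insert_le` (`Sun m`): for a `U`-family `(U(S_l))` and an index `j` missing from `S_{l₀}` and from some other `S_{i₁}`,
  ADDING `j` to `S_{l₀}` does not increase `E_{n+2}`, provided all up-set families of order `≤ n+1` are `≥ 0` under the weight
  (`χ_{U(S ∪ j)} = χ_{U S} + χ_{pet j}`, multilinearity, sign lemma with the cell `{pet j}`).
* **CHAIN** `sahiE_U_insertAll_le`: adding `j` to every member except `i₁` does not increase `E_{n+2}`.
-/

namespace Summit.CriticalPhenomena.PercolationContinuityZ3.Theorems.SahiDeltaSystem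

open Finset Function Literature.Combinatorics.Sahi2008

namespace Sun

section Sign

variable {α : Type*} [Fintype α]

/-- **SIGN LEMMA.**  `E_{N+2}(w, f_0, …, f_N) ≤ 0` when `E(w) ≥ 0`, each `f_i·w ∈ {w, 0}`, some `f_i·w = 0`, and every `P`-family of size `≤ N+1`
has `E ≥ 0` (all `f_i ∈ P`). [this work] -/
theorem sahiE_cons_nonpos_of_cell (μ : α → ℝ) (P : (α → ℝ) → Prop) (w : α → ℝ) (hw : 0 ≤ ex μ w) :
    ∀ (N : ℕ) (f : Fin (N + 1) → α → ℝ), (∀ i, P (f i)) → (∀ i, f i * w = w ∨ f i * w = 0) → (∃ i, f i * w = 0) →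
      (∀ k, k ≤ N + 1 → ∀ g : Fin k → α → ℝ, (∀ i, P (g i)) → 0 ≤ sahiE μ k g) →
        sahiE μ (N + 2) (Fin.cons w f : Fin (N + 2) → α → ℝ) ≤ 0
  | 0, f, hPf, _, ⟨i₁, hi₁⟩, hpos => by
    rw [sahiE_fin_cons, Fin.sum_univ_one]
    have h0 : i₁ = 0 := Fin.eq_zero i₁
    subst h0
    rw [hi₁, sahiE_update_zero]
    have hf : 0 ≤ sahiE μ 1 f := hpos 1 le_rfl f hPf
    nlinarith [mul_nonneg hf hw]
  | N + 1, f, hPf, hcases, ⟨i₁, hi₁⟩, hpos => by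
    rw [sahiE_fin_cons]
    have hterm : ∀ i, sahiE μ (N + 2) (update f i (f i * w)) ≤ 0 := by
      intro i
      rcases hcases i with h | h
      · rw [h]
        by_cases hw0 : w = 0
        · rw [hw0, sahiE_update_zero]
        · have hii₁ : i₁ ≠ i := by
            intro e; apply hw0; rw [← h, ← e, hi₁]
          obtain ⟨k₁, hk₁⟩ := Fin.exists_succAbove_eq hii₁
          rw [SahiMeetTowerAll.sahiE_update_eq_sahiE_cons μ (N + 1) f i w]
          refine sahiE_cons_nonpos_of_cell μ P w hw N (i.removeNth f) (fun k => hPf _) (fun k => hcases _)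
            ⟨k₁, ?_⟩ (fun k hk g hg => hpos k (by omega) g hg)
          rw [Fin.removeNth_apply, hk₁]; exact hi₁
      · rw [h, sahiE_update_zero]
    have hsum : ∑ i, sahiE μ (N + 2) (update f i (f i * w)) ≤ 0 := Finset.sum_nonpos fun i _ => hterm i
    have hf : 0 ≤ sahiE μ (N + 2) f := hpos (N + 2) le_rfl f hPf
    nlinarith [mul_nonneg hf hw]

end Sign

variable {m : ℕ}

/-- `χ_{U (insert j S)} = χ_{U S} + χ_{pet j}` for `j ∉ S`. [this work] -/
theorem setInd_U_insert {j : Fin m} {S : Finset (Fin m)} (h : j ∉ S) :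
    setInd (U (insert j S)) = setInd (U S) + setInd ({pet j} : Finset (Sun m)) := by
  funext y
  rcases y with _ | i | _
  · simp [setInd_apply]
  · by_cases hij : i = j
    · subst hij; simp [setInd_apply, h]
    · simp [setInd_apply, hij, pet_injective.ne hij]
  · simp [setInd_apply]

/-- The cell `{pet j}` is absorbed by `U S` if `j ∈ S` and annihilated otherwise. [this work] -/
theorem setInd_U_mul_setInd_pet (S : Finset (Fin m)) (j : Fin m) :
    setInd (U S) * setInd ({pet j} : Finset (Sun m)) = if j ∈ S then setInd ({pet j} : Finset (Sun m)) else 0 := by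
  rw [setInd_mul]
  by_cases hj : j ∈ S
  · rw [if_pos hj]; congr 1; ext y; rcases y with _ | i | _ <;> simp [hj]
  · rw [if_neg hj]
    have he : U S ∩ ({pet j} : Finset (Sun m)) = ∅ := by
      ext y; rcases y with _ | i | _ <;> simp
      intro hi h; rw [h] at hi; exact hj hi
    rw [he]; funext y; simp [setInd_apply]

/-- **MONOTONE STEP.**  Adding the index `j ∉ S_{l₀}` to the member `S_{l₀}` does not increase `E_{n+2}` of the `U`-family, provided another member
`S_{i₁}` also misses `j` and all up-set families of order `≤ n+1` are `≥ 0` under `ν ≥ 0`. [this work] -/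
theorem sahiE_U_insert_le {ν : Sun m → ℝ} (hν0 : ∀ y, 0 ≤ ν y) {n : ℕ}
    (hlow : ∀ k, k ≤ n + 1 → ∀ W : Fin k → Finset (Sun m), (∀ i, IsUpperSet ((W i : Finset (Sun m)) : Set (Sun m))) →
      0 ≤ sahiE ν k (fun i => setInd (W i)))
    (S : Fin (n + 2) → Finset (Fin m)) {j : Fin m} {l₀ i₁ : Fin (n + 2)} (hl : l₀ ≠ i₁) (h0 : j ∉ S l₀) (h1 : j ∉ S i₁) :
    sahiE ν (n + 2) (fun l => setInd (U (update S l₀ (insert j (S l₀)) l))) ≤ sahiE ν (n + 2) (fun l => setInd (U (S l))) := by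
  set G : Fin (n + 2) → Sun m → ℝ := fun l => setInd (U (S l)) with hG
  have hnew : (fun l => setInd (U (update S l₀ (insert j (S l₀)) l))) = update G l₀ (G l₀ + setInd ({pet j} : Finset (Sun m))) := by
    funext l
    by_cases hl0 : l = l₀
    · subst hl0; rw [update_self, update_self, hG]; exact setInd_U_insert h0
    · rw [update_of_ne hl0, update_of_ne hl0]
  rw [hnew, sahiE_update_add, update_eq_self, SahiMeetTowerAll.sahiE_update_eq_sahiE_cons]
  -- the sign lemma for the cell `{pet j}`
  obtain ⟨k₁, hk₁⟩ := Fin.exists_succAbove_eq (Ne.symm hl)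
  have hw : 0 ≤ ex ν (setInd ({pet j} : Finset (Sun m))) := ex_nonneg hν0 fun y => setInd_nonneg _ _
  have key := sahiE_cons_nonpos_of_cell ν (fun g => ∃ T : Finset (Sun m), IsUpperSet ((T : Finset (Sun m)) : Set (Sun m)) ∧ g = setInd T)
    (setInd ({pet j} : Finset (Sun m))) hw n (l₀.removeNth G)
    (fun k => ⟨U (S (l₀.succAbove k)), isUpperSet_U _, rfl⟩)
    (fun k => by
      rw [Fin.removeNth_apply, hG]; dsimp only
      rw [setInd_U_mul_setInd_pet]
      by_cases hjk : j ∈ S (l₀.succAbove k)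
      · exact Or.inl (if_pos hjk)
      · exact Or.inr (if_neg hjk))
    ⟨k₁, by
      rw [Fin.removeNth_apply, hk₁, hG]; dsimp only
      rw [setInd_U_mul_setInd_pet, if_neg h1]⟩
    (fun k hk g hg => by
      choose T hT using hg
      have hgT : g = fun i => setInd (T i) := funext fun i => (hT i).2
      rw [hgT]
      exact hlow k hk T fun i => (hT i).1)
  linarith

/-- **CHAIN.**  Adding `j` to every member indexed in `M ∌ i₁` (where `j ∉ S_{i₁}`) does not increase `E_{n+2}`. [this work] -/
theorem sahiE_U_insertSet_le {ν : Sun m → ℝ} (hν0 : ∀ y, 0 ≤ ν y) {n : ℕ}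
    (hlow : ∀ k, k ≤ n + 1 → ∀ W : Fin k → Finset (Sun m), (∀ i, IsUpperSet ((W i : Finset (Sun m)) : Set (Sun m))) →
      0 ≤ sahiE ν k (fun i => setInd (W i)))
    (S : Fin (n + 2) → Finset (Fin m)) {j : Fin m} {i₁ : Fin (n + 2)} (h1 : j ∉ S i₁) :
    ∀ M : Finset (Fin (n + 2)), i₁ ∉ M →
      sahiE ν (n + 2) (fun l => setInd (U (if l ∈ M then insert j (S l) else S l))) ≤ sahiE ν (n + 2) (fun l => setInd (U (S l))) := by
  intro M
  induction M using Finset.induction_on with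
  | empty => intro _; simp
  | insert l₀ M hl₀ ih =>
    intro hi₁
    rw [Finset.mem_insert, not_or] at hi₁
    set SM : Fin (n + 2) → Finset (Fin m) := fun l => if l ∈ M then insert j (S l) else S l with hSM
    have hprev := ih hi₁.2
    by_cases hj0 : j ∈ S l₀
    · -- nothing changes at `l₀`
      have hsame : (fun l => setInd (U (if l ∈ insert l₀ M then insert j (S l) else S l))) = fun l => setInd (U (SM l)) := by
        funext l
        by_cases hl : l = l₀
        · subst hl; simp [hSM, hl₀, Finset.insert_eq_of_mem hj0]
        · simp [hSM, Finset.mem_insert, hl]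
      rw [hsame]; exact hprev
    · have hstep : (fun l => setInd (U (if l ∈ insert l₀ M then insert j (S l) else S l))) =
          fun l => setInd (U (update SM l₀ (insert j (SM l₀)) l)) := by
        funext l
        by_cases hl : l = l₀
        · subst hl; simp [hSM, hl₀]
        · simp [hSM, Finset.mem_insert, hl]
      rw [hstep]
      have hSM0 : j ∉ SM l₀ := by simp [hSM, hl₀, hj0]
      have hSM1 : j ∉ SM i₁ := by simp [hSM, hi₁.2, h1]
      exact (sahiE_U_insert_le hν0 hlow SM (Ne.symm hi₁.1) hSM0 hSM1).trans hprev

/-- **CHAIN, all members but one**: making the outside petal `j` PARALLEL to the member `i₁` (adding it to every other member) does not increase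
`E_{n+2}`. [this work] -/
theorem sahiE_U_insertAll_le {ν : Sun m → ℝ} (hν0 : ∀ y, 0 ≤ ν y) {n : ℕ}
    (hlow : ∀ k, k ≤ n + 1 → ∀ W : Fin k → Finset (Sun m), (∀ i, IsUpperSet ((W i : Finset (Sun m)) : Set (Sun m))) →
      0 ≤ sahiE ν k (fun i => setInd (W i)))
    (S : Fin (n + 2) → Finset (Fin m)) {j : Fin m} {i₁ : Fin (n + 2)} (h1 : j ∉ S i₁) :
    sahiE ν (n + 2) (fun l => setInd (U (if l = i₁ then S l else insert j (S l)))) ≤ sahiE ν (n + 2) (fun l => setInd (U (S l))) := by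
  have key := sahiE_U_insertSet_le hν0 hlow S h1 (univ.erase i₁) (Finset.notMem_erase i₁ univ)
  have hfam : (fun l => setInd (U (if l = i₁ then S l else insert j (S l)))) =
      fun l => setInd (U (if l ∈ univ.erase i₁ then insert j (S l) else S l)) := by
    funext l
    by_cases hl : l = i₁
    · subst hl; simp
    · simp [hl]
  rw [hfam]; exact key

end Sun
end Summit.CriticalPhenomena.PercolationContinuityZ3.Theorems.SahiDeltaSystem
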